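import Summits.ValiantsHypothesis.ValiantsHypothesis.Theorems.LacunarySymmetroidMatrixDescartesLagrangeTowerWalk
import Summits.ValiantsHypothesis.ValiantsHypothesis.Theorems.LacunarySymmetroidMatrixDescartesFlagAsymptotics
import Summits.ValiantsHypothesis.ValiantsHypothesis.Theorems.LacunarySymmetroidMatrixDescartesCensusKThreeColumn
import Literature.LinearAlgebra.MatrixPolynomials.CameronPsarrakos2019.Witness
import Summits.ValiantsHypothesis.ValiantsHypothesis.Theorems.LacunarySymmetroidMatrixDescartesCensusThinLaw
import Summits.ValiantsHypothesis.ValiantsHypothesis.Theorems.LacunarySymmetroidMatrixDescartesCensusFormatMonotone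

/-!
# `MatrixDescartes` census — arrowhead Lagrange tower: `KThreeColumnLaw` (CONJECTURE A3) holds — THEOREM L for every `m`

HONEST FRAMING.  Object-search cell `pub-symmetroid`, crux `Theses.LacunarySymmetroid.MatrixDescartes`
(stmt-ValiantsHypothesis-18050); seat val-sym-mdr-p1 (g2).  Part of the kernel port of the cell's THEOREM L (conjb-3 g3, ROUND3-MEMO §1;
paper-checked by conjb-1 g2 and theory g21) in the arrowhead / secular form of `…LagrangeTowerDefs`: for EVERY `m ≥ 1` some real symmetric
three-term lacunary `m × m` pencil has `C(m+2,2) − 1` distinct positive determinant roots, so `KThreeColumnLaw` (CONJECTURE A3) holds.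
This is a LOWER-bound / Descartes-extremality statement for the thin `K = 3` column (CONJECTURE-A currency); it proves nothing about
the crux `MatrixDescartes` (an upper-bound statement at fat formats) and nothing about `VP ≠ VNP`.  No definitions in this file.

THIS FILE. Assembly: symmetry of the letters (`level_symm`), the `OFF`-minor at a test point of window `j` is the level-`j`
determinant (`off_minor_eq`), consecutive test points in a window straddle exactly one root (`det_level_consecutive_neg`), the junction
sign `sgn j` flips across thresholds (`Ewalk_mul_succ_neg`), FLAG ASYMPTOTICS at each of the `C(m+2,2)` test points
(`eventually_sign_at`, from `…FlagAsymptotics`), one large `D` for all of them (`exists_D_alternating`), the sign-alternation root count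
(`Literature…le_card_posRoots_of_alternating`), and the conclusion
`not_posRootLawAt_three : 1 ≤ m → ¬ PosRootLawAt m 3 (C(m+2,2) − 2)` — i.e. `ζ_sym(m,3) = C(m+2,2) − 1 = D(m,3)` for EVERY `m`, with the
Descartes ceiling `Census.kThreeColumn_upper` — and `kThreeColumnLaw_holds : KThreeColumnLaw` via `Census.kThreeColumnLaw_iff`; corollaries `not_posRootLawAt_four_quadratic` (the `K = 4`
column is at least quadratic for every `m`, by zero padding) and `descartesExtremalThin_iff_ladders` (what remains of CONJECTURE (T)).
Witness support `(0, 1, D)`; witness letters `(A_m, B_m, diagonal (sgn_a · thr_a^{−D}))` (B_m and the flag letter diagonal). [folklore]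
-/

-- `Summit.ValiantsHypothesis.ValiantsHypothesis.…` repeats a component by the D-0017 layout
-- (single-conjunct summit), which the `dupNamespace` linter flags; the name is mandated.
set_option linter.dupNamespace false

namespace Summit.ValiantsHypothesis.ValiantsHypothesis.Theorems.LacunarySymmetroidMatrixDescartes.Census.LagrangeTower

open Matrix Polynomial Finset
open scoped BigOperators

section Assembly

open Filter Topology

/-- Both letters of a good level are symmetric (`A = U D Uᵀ`). -/
theorem level_symm {k : ℕ} (d : TowerData k) (hd : d.Good) : d.A.IsSymm ∧ d.B.IsSymm := by
  have hWU : d.Wᵀ * d.U = 1 := hd.2.1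
  have hUW : d.U * d.Wᵀ = 1 := mul_eq_one_comm.mp hWU
  have hWUt : d.W * d.Uᵀ = 1 := by
    have := congrArg Matrix.transpose hUW
    rwa [Matrix.transpose_mul, Matrix.transpose_transpose, Matrix.transpose_one] at this
  have key : ∀ (M D : Matrix (Fin k) (Fin k) ℝ), d.Wᵀ * M * d.W = D → Dᵀ = D → M.IsSymm := by
    intro M D h hD
    have hM : M = d.U * D * d.Uᵀ := by
      calc M = (d.U * d.Wᵀ) * M * (d.W * d.Uᵀ) := by rw [hUW, hWUt, Matrix.one_mul, Matrix.mul_one]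
        _ = d.U * (d.Wᵀ * M * d.W) * d.Uᵀ := by simp only [Matrix.mul_assoc]
        _ = d.U * D * d.Uᵀ := by rw [h]
    unfold Matrix.IsSymm
    rw [hM, Matrix.transpose_mul, Matrix.transpose_mul, Matrix.transpose_transpose, hD, Matrix.mul_assoc]
  exact ⟨key _ _ (W_A_W d hd) (Matrix.diagonal_transpose _), key _ _ (W_B_W d hd) (Matrix.diagonal_transpose _)⟩

/-- A principal minor on the coordinates `{a : a < j}`, seen through a subtype, is the leading `j × j` minor. -/
theorem det_submatrix_subtype_eq {m j : ℕ} (h : j ≤ m) (M : Matrix (Fin m) (Fin m) ℝ) (S : Finset (Fin m))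
    (hS : ∀ a, a ∈ S ↔ (a : ℕ) < j) :
    Matrix.det (M.submatrix ((↑) : ↥S → Fin m) ((↑) : ↥S → Fin m))
      = Matrix.det (M.submatrix (Fin.castLE h) (Fin.castLE h)) := by
  let e : Fin j ≃ ↥S :=
    { toFun := fun i => ⟨Fin.castLE h i, (hS _).mpr i.isLt⟩
      invFun := fun a => ⟨(a.1 : ℕ), (hS a.1).mp a.2⟩
      left_inv := fun i => Fin.ext rfl
      right_inv := fun a => Subtype.ext (Fin.ext rfl) }
  rw [← Matrix.det_submatrix_equiv_self e]
  rfl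

/-- `0 < spt j r / thr a`. -/
theorem ratio_pos (j r a : ℕ) : 0 < spt j r / thr a := div_pos (spt_pos j r) (thr_pos a)

/-- Coordinate `a` is ON at the test points of window `j` iff `j ≤ a`. -/
theorem one_lt_ratio_iff {j r : ℕ} (hr : r ≤ j) (a : ℕ) : 1 < spt j r / thr a ↔ j ≤ a := by
  rw [one_lt_div (thr_pos a)]
  constructor
  · intro h
    by_contra hc
    exact absurd h (not_lt.mpr (spt_lt_thr (not_le.mp hc) hr).le)
  · intro h; exact thr_lt_spt h r

/-- No test point sits exactly on a threshold. -/
theorem ratio_ne_one {j r : ℕ} (hr : r ≤ j) (a : ℕ) : spt j r / thr a ≠ 1 := by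
  intro h
  rcases Nat.lt_or_ge a j with ha | ha
  · have := spt_lt_thr ha hr
    rw [div_eq_one_iff_eq (thr_pos a).ne'] at h
    exact absurd this (by rw [h]; exact lt_irrefl _)
  · have := thr_lt_spt ha r
    rw [div_eq_one_iff_eq (thr_pos a).ne'] at h
    exact absurd this (by rw [h]; exact lt_irrefl _)

/-- The ON set at a test point of window `j` is `{a : j ≤ a}`. -/
theorem filter_on_eq {m j r : ℕ} (hr : r ≤ j) :
    (univ.filter (fun a : Fin m => 1 < spt j r / thr a)) = univ.filter (fun a : Fin m => j ≤ (a : ℕ)) := by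
  ext a
  simp only [Finset.mem_filter, Finset.mem_univ, true_and, one_lt_ratio_iff hr]

/-- The OFF set at a test point of window `j` is `{a : a < j}`. -/
theorem mem_off_iff {m j r : ℕ} (hr : r ≤ j) (a : Fin m) :
    a ∈ (univ.filter (fun a : Fin m => 1 < spt j r / thr a))ᶜ ↔ (a : ℕ) < j := by
  rw [filter_on_eq hr, Finset.mem_compl, Finset.mem_filter]
  simp

/-- The `OFF`-minor of the size-`m` pencil at a test point of window `j ≤ m` is the determinant of level `j` there. -/
theorem off_minor_eq {m j r : ℕ} (h : j ≤ m) (hr : r ≤ j) :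
    Matrix.det (((tower m).A + spt j r • (tower m).B).submatrix
        ((↑) : ↥(univ.filter (fun a : Fin m => 1 < spt j r / thr a))ᶜ → Fin m)
        ((↑) : ↥(univ.filter (fun a : Fin m => 1 < spt j r / thr a))ᶜ → Fin m))
      = Matrix.det ((tower j).A + spt j r • (tower j).B) := by
  rw [det_submatrix_subtype_eq h _ _ (mem_off_iff hr), ← pminor_eq m j h]
  rfl

/-- The level-`j` determinant does not vanish off the designed roots. -/
theorem sgn_ne_zero_aux {j : ℕ} (t : ℝ) (ht : ∀ i : Fin j, t ≠ zroot j i) :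
    Matrix.det ((tower j).A + t • (tower j).B) ≠ 0 := by
  have hg := tower_good j
  have hprod : ∏ i, (tower j).β i * (t - zroot j i) ≠ 0 := by
    refine Finset.prod_ne_zero_iff.mpr fun i _ => mul_ne_zero ?_ (sub_ne_zero.mpr (ht i))
    intro h0; have := hg.2.2.2 i; rw [h0, mul_zero] at this; exact lt_irrefl _ this
  intro h0
  have := det_level (tower j) hg t
  rw [h0, mul_zero] at this
  exact hprod this.symm

/-- Test points are not roots. -/
theorem spt_ne_zroot {j r : ℕ} (i : Fin j) : spt j r ≠ zroot j i := by
  intro h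
  rcases Nat.lt_or_ge (i : ℕ) r with hi | hi
  · have := (zroot_lt_spt_iff j r i).mpr hi; rw [h] at this; exact lt_irrefl _ this
  · have := (spt_lt_zroot_iff j r i).mpr hi; rw [h] at this; exact lt_irrefl _ this

/-- The level-`j` determinant does not vanish at test points. -/
theorem det_level_spt_ne_zero (j r : ℕ) : Matrix.det ((tower j).A + spt j r • (tower j).B) ≠ 0 :=
  sgn_ne_zero_aux _ fun i => spt_ne_zroot i

/-- Flag signs are nonzero. -/
theorem sgn_ne_zero (a : ℕ) : sgn a ≠ 0 := by
  unfold sgn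
  exact neg_ne_zero.mpr (mul_ne_zero (det_level_spt_ne_zero _ _) (det_level_spt_ne_zero _ _))

/-- `levelSign m j ≠ 0`. -/
theorem levelSign_ne_zero (m j : ℕ) : levelSign m j ≠ 0 :=
  Finset.prod_ne_zero_iff.mpr fun a _ => sgn_ne_zero a

/-- **Within a window**: consecutive test points `spt j r < spt j (r+1)` (`r < j`) straddle exactly one root of level `j`,
so the leading minor changes sign. -/
theorem det_level_consecutive_neg {j r : ℕ} (hr : r < j) :
    Matrix.det ((tower j).A + spt j r • (tower j).B) * Matrix.det ((tower j).A + spt j (r + 1) • (tower j).B) < 0 := by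
  have hg := tower_good j
  set d := tower j
  have h1 := det_level d hg (spt j r)
  have h2 := det_level d hg (spt j (r + 1))
  have hW : 0 < d.W.det ^ 2 := by have := det_W_ne_zero d hg; positivity
  -- the product of the two diagonal forms is negative
  have hprod : (∏ i, d.β i * (spt j r - zroot j i)) * (∏ i, d.β i * (spt j (r + 1) - zroot j i)) < 0 := by
    rw [← Finset.prod_mul_distrib]
    -- split off the straddled root `i₀ = ⟨r, hr⟩`
    let i₀ : Fin j := ⟨r, hr⟩
    rw [← Finset.mul_prod_erase _ _ (Finset.mem_univ i₀)]
    have hneg : d.β i₀ * (spt j r - zroot j i₀) * (d.β i₀ * (spt j (r + 1) - zroot j i₀)) < 0 := by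
      have hb : d.β i₀ ≠ 0 := by
        intro h0; have := hg.2.2.2 i₀; rw [h0, mul_zero] at this; exact lt_irrefl _ this
      have ha : spt j r - zroot j i₀ < 0 := sub_neg.mpr ((spt_lt_zroot_iff j r i₀).mpr le_rfl)
      have hc : 0 < spt j (r + 1) - zroot j i₀ := sub_pos.mpr ((zroot_lt_spt_iff j (r + 1) i₀).mpr (Nat.lt_succ_self r))
      have : d.β i₀ * (spt j r - zroot j i₀) * (d.β i₀ * (spt j (r + 1) - zroot j i₀))
          = (d.β i₀ * d.β i₀) * ((spt j r - zroot j i₀) * (spt j (r + 1) - zroot j i₀)) := by ring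
      rw [this]
      exact mul_neg_of_pos_of_neg (mul_self_pos.mpr hb) (mul_neg_of_neg_of_pos ha hc)
    have hpos : 0 < ∏ i ∈ univ.erase i₀, d.β i * (spt j r - zroot j i) * (d.β i * (spt j (r + 1) - zroot j i)) := by
      refine Finset.prod_pos fun i hi => ?_
      have hne : (i : ℕ) ≠ r := fun h => (Finset.mem_erase.mp hi).1 (Fin.ext h)
      have hb : d.β i ≠ 0 := by
        intro h0; have := hg.2.2.2 i; rw [h0, mul_zero] at this; exact lt_irrefl _ this
      have : d.β i * (spt j r - zroot j i) * (d.β i * (spt j (r + 1) - zroot j i))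
          = (d.β i * d.β i) * ((spt j r - zroot j i) * (spt j (r + 1) - zroot j i)) := by ring
      rw [this]
      refine mul_pos (mul_self_pos.mpr hb) ?_
      rcases Nat.lt_or_gt_of_ne hne with hlt | hgt
      · -- root below both points
        have ha : 0 < spt j r - zroot j i := sub_pos.mpr ((zroot_lt_spt_iff j r i).mpr hlt)
        have hc : 0 < spt j (r + 1) - zroot j i := sub_pos.mpr ((zroot_lt_spt_iff j (r + 1) i).mpr (by omega))
        exact mul_pos ha hc
      · -- root above both points
        have ha : spt j r - zroot j i < 0 := sub_neg.mpr ((spt_lt_zroot_iff j r i).mpr hgt.le)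
        have hc : spt j (r + 1) - zroot j i < 0 := sub_neg.mpr ((spt_lt_zroot_iff j (r + 1) i).mpr (by omega))
        exact mul_pos_of_neg_of_neg ha hc
    exact mul_neg_of_neg_of_pos hneg hpos
  rw [← h1, ← h2] at hprod
  have : d.W.det ^ 2 * Matrix.det (d.A + spt j r • d.B) * (d.W.det ^ 2 * Matrix.det (d.A + spt j (r + 1) • d.B))
      = (d.W.det ^ 2 * d.W.det ^ 2) * (Matrix.det (d.A + spt j r • d.B) * Matrix.det (d.A + spt j (r + 1) • d.B)) := by
    ring
  rw [this] at hprod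
  rcases mul_neg_iff.mp hprod with ⟨_, h⟩ | ⟨h, _⟩
  · exact h
  · exact absurd h (not_lt.mpr (by positivity))

/-- `levelSign m j = sgn j · levelSign m (j+1)` for `j < m`. -/
theorem levelSign_succ {m j : ℕ} (hj : j < m) : levelSign m j = sgn j * levelSign m (j + 1) := by
  unfold levelSign
  have : univ.filter (fun a : Fin m => j ≤ (a : ℕ)) = insert ⟨j, hj⟩ (univ.filter (fun a : Fin m => j + 1 ≤ (a : ℕ))) := by
    ext a
    simp only [Finset.mem_filter, Finset.mem_univ, true_and, Finset.mem_insert, Fin.ext_iff]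
    omega
  rw [this, Finset.prod_insert]
  simp

/-- **Consecutive limiting signs are opposite** along the walk. -/
theorem Ewalk_mul_succ_neg (m n : ℕ) (hn : n < tri (m + 1) - 1) : Ewalk m n * Ewalk m (n + 1) < 0 := by
  obtain ⟨h1, h2, h3⟩ := walk_inv m n hn.le
  unfold Ewalk pts
  rcases walk_step m n hn with ⟨hlt, hw⟩ | ⟨heq, hj, hw⟩
  · -- inside window j
    rw [hw]
    simp only
    have hneg := det_level_consecutive_neg hlt
    have hL := levelSign_ne_zero m (walk m n).1
    have : levelSign m (walk m n).1 * Matrix.det ((tower (walk m n).1).A + spt (walk m n).1 (walk m n).2 • (tower (walk m n).1).B) *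
        (levelSign m (walk m n).1 * Matrix.det ((tower (walk m n).1).A + spt (walk m n).1 ((walk m n).2 + 1) • (tower (walk m n).1).B))
        = (levelSign m (walk m n).1 * levelSign m (walk m n).1) *
          (Matrix.det ((tower (walk m n).1).A + spt (walk m n).1 (walk m n).2 • (tower (walk m n).1).B) *
            Matrix.det ((tower (walk m n).1).A + spt (walk m n).1 ((walk m n).2 + 1) • (tower (walk m n).1).B)) := by ring
    rw [this]
    exact mul_neg_of_pos_of_neg (mul_self_pos.mpr hL) hneg
  · -- junction from the top of window j to the bottom of window j−1
    rw [hw]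
    simp only
    set j := (walk m n).1 with hjdef
    rw [heq]
    obtain ⟨j', hj'⟩ : ∃ j', j = j' + 1 := ⟨j - 1, by omega⟩
    have hjm : j' < m := by omega
    rw [hj', show j' + 1 - 1 = j' from rfl, levelSign_succ hjm]
    have hL := levelSign_ne_zero m (j' + 1)
    have hs : sgn j' = -(Matrix.det ((tower (j' + 1)).A + spt (j' + 1) (j' + 1) • (tower (j' + 1)).B) *
        Matrix.det ((tower j').A + spt j' 0 • (tower j').B)) := rfl
    set P := Matrix.det ((tower (j' + 1)).A + spt (j' + 1) (j' + 1) • (tower (j' + 1)).B)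
    set Q := Matrix.det ((tower j').A + spt j' 0 • (tower j').B)
    have hP : P ≠ 0 := det_level_spt_ne_zero _ _
    have hQ : Q ≠ 0 := det_level_spt_ne_zero _ _
    rw [hs]
    have : levelSign m (j' + 1) * P * (-(P * Q) * levelSign m (j' + 1) * Q)
        = -((levelSign m (j' + 1) * levelSign m (j' + 1)) * ((P * Q) * (P * Q))) := by ring
    rw [this]
    exact neg_neg_of_pos (mul_pos (mul_self_pos.mpr hL) (mul_self_pos.mpr (mul_ne_zero hP hQ)))

/-- Evaluating the witness pencil at `t`. -/
theorem eval_det_witness (m D : ℕ) (t : ℝ) :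
    (Matrix.det (∑ l, ((Polynomial.X : Polynomial ℝ) ^ witnessExps D l) • (witnessLetters m D l).map Polynomial.C)).eval t
      = Matrix.det ((tower m).A + t • (tower m).B + diagonal (fun a : Fin m => sgn a * (t / thr a) ^ D)) := by
  have h := RingHom.map_det (Polynomial.evalRingHom t)
    (∑ l, ((Polynomial.X : Polynomial ℝ) ^ witnessExps D l) • (witnessLetters m D l).map Polynomial.C)
  rw [Polynomial.coe_evalRingHom] at h
  rw [h]
  congr 1
  ext i j
  simp only [RingHom.mapMatrix_apply, Matrix.map_apply, Matrix.smul_apply, smul_eq_mul,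
    Polynomial.coe_evalRingHom, Fin.sum_univ_three, witnessExps, witnessLetters, flagLetter,
    Matrix.cons_val_zero, Matrix.cons_val_one, Matrix.cons_val_two, Matrix.head_cons, Matrix.tail_cons,
    pow_zero, one_mul, pow_one, Matrix.add_apply, Matrix.diagonal_apply]
  split_ifs with hij
  · simp only [Polynomial.eval_add, Polynomial.eval_mul, Polynomial.eval_pow, Polynomial.eval_X, Polynomial.eval_C]
    rw [div_pow, inv_pow]; ring
  · simp only [Polynomial.eval_add, Polynomial.eval_mul, Polynomial.eval_pow, Polynomial.eval_X, Polynomial.eval_C]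
    ring

/-- At the `n`-th test point, for all large `D`, the witness determinant has the sign of `Ewalk m n`. -/
theorem eventually_sign_at (m n : ℕ) (hn : n ≤ tri (m + 1) - 1) :
    ∀ᶠ D : ℕ in atTop,
      0 < Matrix.det ((tower m).A + pts m n • (tower m).B + diagonal (fun a : Fin m => sgn a * (pts m n / thr a) ^ D)) *
        Ewalk m n := by
  obtain ⟨h1, h2, h3⟩ := walk_inv m n hn
  have hflag := Flag.eventually_det_mul_pos ((tower m).A + pts m n • (tower m).B) (fun a : Fin m => sgn a)
    (fun a : Fin m => pts m n / thr a) (fun a => sgn_ne_zero a) (fun a => ratio_pos _ _ _)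
    (fun a => ratio_ne_one h1 a) ?_
  · have hE : (∏ a ∈ univ.filter (fun a : Fin m => 1 < pts m n / thr a), sgn (a : ℕ)) *
        Matrix.det (((tower m).A + pts m n • (tower m).B).submatrix
          ((↑) : ↥(univ.filter (fun a : Fin m => 1 < pts m n / thr a))ᶜ → Fin m)
          ((↑) : ↥(univ.filter (fun a : Fin m => 1 < pts m n / thr a))ᶜ → Fin m))
        = Ewalk m n := by
      unfold Ewalk levelSign pts
      rw [off_minor_eq h2 h1, filter_on_eq h1]
    rw [← hE]
    exact hflag
  · unfold pts
    rw [off_minor_eq h2 h1]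
    exact det_level_spt_ne_zero _ _

/-- **Alternation at every step, for one large `D`.** -/
theorem exists_D_alternating (m : ℕ) :
    ∃ D : ℕ, ∀ n : ℕ, n < tri (m + 1) - 1 →
      Matrix.det ((tower m).A + pts m n • (tower m).B + diagonal (fun a : Fin m => sgn a * (pts m n / thr a) ^ D)) *
        Matrix.det ((tower m).A + pts m (n + 1) • (tower m).B +
          diagonal (fun a : Fin m => sgn a * (pts m (n + 1) / thr a) ^ D)) < 0 := by
  set N := tri (m + 1) - 1
  have hall : ∀ᶠ D : ℕ in atTop, ∀ n : Fin N,
      Matrix.det ((tower m).A + pts m n • (tower m).B + diagonal (fun a : Fin m => sgn a * (pts m n / thr a) ^ D)) *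
        Matrix.det ((tower m).A + pts m (n + 1) • (tower m).B +
          diagonal (fun a : Fin m => sgn a * (pts m (n + 1) / thr a) ^ D)) < 0 := by
    refine eventually_all.mpr fun n => ?_
    have ha := eventually_sign_at m n (by omega)
    have hb := eventually_sign_at m (n + 1) (by omega)
    have hE := Ewalk_mul_succ_neg m n n.isLt
    filter_upwards [ha, hb] with D hDa hDb
    -- (x·e > 0) ∧ (y·e' > 0) ∧ (e e' < 0) ⇒ x y < 0
    set x := Matrix.det ((tower m).A + pts m n • (tower m).B + diagonal (fun a : Fin m => sgn a * (pts m n / thr a) ^ D))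
    set y := Matrix.det ((tower m).A + pts m (n + 1) • (tower m).B +
      diagonal (fun a : Fin m => sgn a * (pts m (n + 1) / thr a) ^ D))
    have hxy : (x * y) * (Ewalk m n * Ewalk m (n + 1)) > 0 := by
      have : (x * y) * (Ewalk m n * Ewalk m (n + 1)) = (x * Ewalk m n) * (y * Ewalk m (n + 1)) := by ring
      rw [this]; exact mul_pos hDa hDb
    by_contra hc
    have hc' : 0 ≤ x * y := not_lt.mp hc
    have := mul_nonpos_of_nonneg_of_nonpos hc' hE.le
    exact absurd hxy (not_lt.mpr this)
  obtain ⟨D, hD⟩ := hall.exists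
  exact ⟨D, fun n hn => hD ⟨n, hn⟩⟩

/-- The witness letters are symmetric. -/
theorem witnessLetters_isSymm (m D : ℕ) (l : Fin 3) : (witnessLetters m D l).IsSymm := by
  have h := level_symm (tower m) (tower_good m)
  fin_cases l
  · exact h.1
  · exact h.2
  · show (flagLetter m D).IsSymm
    exact Matrix.diagonal_transpose _

open Summit.ValiantsHypothesis.ValiantsHypothesis.Theorems.MatrixDescartes.Negative (PosRootLawAt) in
/-- **THEOREM L (conjb-3), kernel form: the `K = 3` column is Descartes-extremal for every `m ≥ 1`** —
`¬ PosRootLawAt m 3 (C(m+2,2) − 2)`, i.e. some real symmetric three-term `m × m` lacunary pencil has `C(m+2,2) − 1` distinct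
positive determinant roots (witness: the arrowhead Lagrange tower with a flag letter of large lacunarity `D`). -/
theorem not_posRootLawAt_three (m : ℕ) (hm : 1 ≤ m) : ¬ PosRootLawAt m 3 (Nat.choose (m + 2) 2 - 2) := by
  intro hlaw
  obtain ⟨D, hD⟩ := exists_D_alternating m
  set N := tri (m + 1) - 1 with hN
  have hNchoose : tri (m + 1) = Nat.choose (m + 2) 2 := tri_eq_choose (m + 1)
  have htri2 : 2 ≤ tri (m + 1) := by
    rw [show tri (m + 1) = tri m + (m + 1) from rfl]
    have : 1 ≤ tri m := by
      obtain ⟨m', rfl⟩ : ∃ m', m = m' + 1 := ⟨m - 1, by omega⟩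
      rw [show tri (m' + 1) = tri m' + (m' + 1) from rfl]; omega
    omega
  -- the alternating sequence of test points
  let τ : Fin (N + 1) → ℝ := fun i => pts m i
  have hτ : StrictMono τ := by
    refine Fin.strictMono_iff_lt_succ.mpr fun i => ?_
    show pts m (Fin.castSucc i) < pts m i.succ
    rw [Fin.val_castSucc, Fin.val_succ]
    exact pts_lt_succ m i (by omega)
  have hpos : ∀ i, 0 < τ i := fun i => pts_pos m i
  set p := Matrix.det (∑ l, ((Polynomial.X : Polynomial ℝ) ^ witnessExps D l) • (witnessLetters m D l).map Polynomial.C)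
    with hp
  have halt : ∀ i : Fin N, p.eval (τ i.castSucc) * p.eval (τ i.succ) < 0 := by
    intro i
    show p.eval (pts m (Fin.castSucc i)) * p.eval (pts m i.succ) < 0
    rw [Fin.val_castSucc, Fin.val_succ, hp, eval_det_witness, eval_det_witness]
    exact hD i i.isLt
  have hcount := Literature.LinearAlgebra.MatrixPolynomials.CameronPsarrakos2019.le_card_posRoots_of_alternating p N τ hτ hpos halt
  have hbound := hlaw (witnessExps D) (witnessLetters m D) (witnessLetters_isSymm m D)
  rw [← hp] at hbound
  omega

open Summit.ValiantsHypothesis.ValiantsHypothesis.Theorems.MatrixDescartes.Negative (PosRootLawAt) in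
/-- **CONJECTURE A3 (`KThreeColumnLaw`) IS A THEOREM**: `ζ(m,3) = C(m+2,2) − 1 = D(m,3)` for every `m ≥ 1` — the upper half is the
Descartes ceiling (tree), the lower half is `not_posRootLawAt_three`. -/
theorem kThreeColumnLaw_holds : KThreeColumnLaw :=
  kThreeColumnLaw_iff.mpr fun m hm => not_posRootLawAt_three m hm

open Summit.ValiantsHypothesis.ValiantsHypothesis.Theorems.MatrixDescartes.Negative (PosRootLawAt) in
/-- **Corollary (the `K = 4` column is at least quadratic, every `m`)**: `¬ PosRootLawAt m 4 (C(m+2,2) − 2)`, i.e.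
`ζ_sym(m,4) ≥ C(m+2,2) − 1` — by zero-padding the three-term witness (`Census.posRootLawAt_of_le_terms`).  The cell's open fork is whether this
column is cubic; nothing here bears on it beyond the quadratic floor. -/
theorem not_posRootLawAt_four_quadratic (m : ℕ) (hm : 1 ≤ m) : ¬ PosRootLawAt m 4 (Nat.choose (m + 2) 2 - 2) :=
  fun h => not_posRootLawAt_three m hm (posRootLawAt_of_le_terms (by norm_num) h)

open Summit.ValiantsHypothesis.ValiantsHypothesis.Theorems.MatrixDescartes.Negative (PosRootLawAt) in
/-- **What remains of `DescartesExtremalThin` (CONJECTURE (T), thin scope) after A3**: exactly the two ladders — the `m = 2` ladder from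
`K = 6` on (`ζ_sym(2,K) = C(K+1,2) − 1`; its first instance is the negation side of `DoorA26`) and the `m = 3` ladder from `K = 4` on
(`ζ_sym(3,K) = C(K+2,3) − 1`; first instance = the negation side of `DoorA34`).  The `K = 3` column conjunct of `Census.descartesExtremalThin_iff_open`
is discharged by `not_posRootLawAt_three`. -/
theorem descartesExtremalThin_iff_ladders :
    DescartesExtremalThin ↔
      (∀ K : ℕ, 6 ≤ K → ¬ PosRootLawAt 2 K (Nat.choose (K + 1) 2 - 2)) ∧
      (∀ K : ℕ, 4 ≤ K → ¬ PosRootLawAt 3 K (Nat.choose (K + 2) 3 - 2)) := by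
  rw [descartesExtremalThin_iff_open]
  exact ⟨fun h => ⟨h.2.1, h.2.2⟩, fun h => ⟨fun m hm => not_posRootLawAt_three m (by omega), h.1, h.2⟩⟩

end Assembly

end Summit.ValiantsHypothesis.ValiantsHypothesis.Theorems.LacunarySymmetroidMatrixDescartes.Census.LagrangeTower
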